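import Summits.RiemannHypothesis.RiemannHypothesis.Theorems.SoloInformedNonDegenerate
import Literature.NumberTheory.LFunctions.SchoenfeldZeroSums
import HarnessLib

/-!
# T72b — the zero side over a window, with multiplicity (solo-informed, rigidity line R3)

Second file of the local pair-correlation rigidity line (sharpest statement §2k (xi), plan T72).
Under RH the zero side of the explicit formula for `g ⋆ g̃` is a series of non-negative terms
`m(ρ) |ĝ(ρ)|²`, so every truncation is dominated by the full sum `Re Q(g)`:

* `sum_weilZeroIndex_le_re_weilQuadratic` — under RH, for every `T`,
  `∑_{ρ ∈ weilZeroIndex T} m(ρ) |ĝ(ρ)|² ≤ Re Q(g)` (multiplicity-weighted; the tree's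
  `sum_norm_sq_weilMellin_le_re_weilQuadratic` is the same bound over a finite set of ordinates,
  each counted once).
* `mul_zetaZeroCount_sub_le_re_weilQuadratic` — **window mass bound**: under RH, if
  `|ĝ(ρ)|² ≥ m` for every zero `ρ` with `T₁ < Im ρ ≤ T₂` (`0 ≤ T₁ ≤ T₂`, `m` real), then
  `m · (N(T₂) − N(T₁)) ≤ Re Q(g)`, the count `N` WITH multiplicity (`zetaZeroCount`). This is the
  form in which the zero side enters Lemma 2k.E: a probe whose transform is `≥ bμ` on a window of
  ordinates sees at least `bμ` times the Riemann–von Mangoldt mass of that window, multiple zeros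
  included, so that no hypothesis on multiplicities is needed downstream.

References: E. Bombieri, *Remarks on Weil's quadratic functional in the theory of prime numbers
I*, Rend. Mat. Acc. Lincei (9) 11 (2000) 183–233, §3 (3.2) and Thm 2 (key `Bombieri2000Weil`);
E. C. Titchmarsh, *The theory of the Riemann zeta-function*, 2nd ed. (1986), §9.1 (`N(T)` with
multiplicity; key `Titchmarsh1986`).
-/

noncomputable section

open Complex Filter Set Topology MeasureTheory
open Literature.NumberTheory.LFunctions
open scoped Real

namespace Summit.RiemannHypothesis.RiemannHypothesis.Theorems

/-- Under RH every term of a truncated zero side of `g ⋆ g̃` is real and non-negative: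
for `ρ ∈ weilZeroIndex T`, `Re(m(ρ) · (g ⋆ g̃)^(ρ)) = m(ρ) |ĝ(ρ)|²` with `m(ρ) ≥ 0`. -/
theorem re_term_weilZeroIndex (hRH : _root_.RiemannHypothesis) {g : ℝ → ℂ} (hg : IsWeilTest g)
    {T : ℝ} {z : ℂ} (hz : z ∈ weilZeroIndex T) :
    ((riemannZetaZeroOrder z : ℂ) * weilMellin (weilConv g (weilReflect g)) z).re =
        (riemannZetaZeroOrder z : ℝ) * ‖weilMellin g z‖ ^ 2 ∧
      (0 : ℝ) ≤ riemannZetaZeroOrder z := by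
  obtain ⟨hζ, -, -, him, -⟩ := hz
  have hne : z ≠ 1 := by
    rintro rfl
    simp at him
  have hzre : z.re = 1 / 2 := by
    refine hRH z hζ ?_ hne
    rintro ⟨n, rfl⟩
    simp at him
  refine ⟨?_, by exact_mod_cast riemannZetaZeroOrder_nonneg hne⟩
  rw [weilMellin_weilQuadratic_of_re_eq hg hzre, ← Complex.ofReal_intCast, ← Complex.ofReal_mul,
    Complex.ofReal_re, Complex.normSq_eq_norm_sq]

/-- Under RH the real part of the truncated zero side of `g ⋆ g̃` at height `T` is the finite sum
`∑_{ρ ∈ weilZeroIndex T} m(ρ) |ĝ(ρ)|²`. -/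
theorem re_weilZeroSidePartial_eq_sum (hRH : _root_.RiemannHypothesis) {g : ℝ → ℂ}
    (hg : IsWeilTest g) (T : ℝ) :
    (weilZeroSidePartial (weilConv g (weilReflect g)) T).re =
      ∑ z ∈ (weilZeroIndex_finite T).toFinset,
        (riemannZetaZeroOrder z : ℝ) * ‖weilMellin g z‖ ^ 2 := by
  unfold weilZeroSidePartial
  rw [finsum_mem_eq_finite_toFinset_sum _ (weilZeroIndex_finite T), Complex.re_sum]
  exact Finset.sum_congr rfl fun z hz ↦
    (re_term_weilZeroIndex hRH hg ((Set.Finite.mem_toFinset _).1 hz)).1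

/-- **Truncations are dominated (RH).** Under RH, for every test `g` and every height `T`,
`∑_{ρ ∈ weilZeroIndex T} m(ρ) |ĝ(ρ)|² ≤ Re Q(g)`: the truncated zero sides increase with `T`
(non-negative terms on increasing index sets) and converge to `Q(g)` (explicit formula).
[cite: Bombieri2000Weil, §3 (3.2), Thm 2] -/
theorem sum_weilZeroIndex_le_re_weilQuadratic (hRH : _root_.RiemannHypothesis) {g : ℝ → ℂ}
    (hg : IsWeilTest g) (T : ℝ) :
    ∑ z ∈ (weilZeroIndex_finite T).toFinset,
        (riemannZetaZeroOrder z : ℝ) * ‖weilMellin g z‖ ^ 2 ≤ (weilQuadratic g).re := by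
  classical
  have hkt : IsWeilTest (weilConv g (weilReflect g)) := hg.weilConv hg.weilReflect
  have hlim : Tendsto (fun T' ↦ (weilZeroSidePartial (weilConv g (weilReflect g)) T').re) atTop
      (𝓝 (weilQuadratic g).re) :=
    (Complex.continuous_re.tendsto _).comp (explicit_formula_holds hkt)
  refine ge_of_tendsto hlim ?_
  rw [Filter.eventually_atTop]
  refine ⟨T, fun T' hT' ↦ ?_⟩
  rw [re_weilZeroSidePartial_eq_sum hRH hg T']
  have hsub : (weilZeroIndex_finite T).toFinset ⊆ (weilZeroIndex_finite T').toFinset := by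
    intro z hz
    rw [Set.Finite.mem_toFinset] at hz ⊢
    obtain ⟨h0, h1, h2, h3, h4⟩ := hz
    exact ⟨h0, h1, h2, h3, h4.trans hT'⟩
  exact Finset.sum_le_sum_of_subset_of_nonneg hsub fun z hz _ ↦
    mul_nonneg (re_term_weilZeroIndex hRH hg ((Set.Finite.mem_toFinset _).1 hz)).2 (sq_nonneg _)

/-- **Window mass bound (RH).** Under RH, if `0 ≤ T₁ ≤ T₂` and `|ĝ(ρ)|² ≥ m` for every
zero `ρ` of `ζ` with `T₁ < Im ρ ≤ T₂`, then `m · (N(T₂) − N(T₁)) ≤ Re Q(g)`, where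
`N = zetaZeroCount` counts WITH multiplicity. [cite: Titchmarsh1986, §9.1] -/
theorem mul_zetaZeroCount_sub_le_re_weilQuadratic (hRH : _root_.RiemannHypothesis) {g : ℝ → ℂ}
    (hg : IsWeilTest g) {T₁ T₂ m : ℝ} (h0 : 0 ≤ T₁) (h12 : T₁ ≤ T₂)
    (hlow : ∀ ρ : ℂ, riemannZeta ρ = 0 → T₁ < ρ.im → ρ.im ≤ T₂ → m ≤ ‖weilMellin g ρ‖ ^ 2) :
    m * ((zetaZeroCount T₂ : ℝ) - zetaZeroCount T₁) ≤ (weilQuadratic g).re := by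
  classical
  rw [SchoenfeldBound.zetaZeroCount_sub_eq_sum h12, Finset.mul_sum]
  have hsub : SchoenfeldBound.zerosBetween T₁ T₂ ⊆ (weilZeroIndex_finite T₂).toFinset := by
    intro ρ hρ
    rw [SchoenfeldBound.mem_zerosBetween h0] at hρ
    obtain ⟨hz, h1, h2, h3, h4⟩ := hρ
    rw [Set.Finite.mem_toFinset]
    have hpos : 0 < ρ.im := h0.trans_lt h3
    exact ⟨hz, h1, h2, hpos.ne', by rwa [abs_of_pos hpos]⟩
  calc ∑ ρ ∈ SchoenfeldBound.zerosBetween T₁ T₂, m * (riemannZetaZeroOrder ρ : ℝ)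
      ≤ ∑ ρ ∈ SchoenfeldBound.zerosBetween T₁ T₂,
          (riemannZetaZeroOrder ρ : ℝ) * ‖weilMellin g ρ‖ ^ 2 := by
        refine Finset.sum_le_sum fun ρ hρ ↦ ?_
        have hord := (re_term_weilZeroIndex hRH hg ((Set.Finite.mem_toFinset _).1 (hsub hρ))).2
        rw [SchoenfeldBound.mem_zerosBetween h0] at hρ
        obtain ⟨hz, -, -, h3, h4⟩ := hρ
        rw [mul_comm]
        exact mul_le_mul_of_nonneg_left (hlow ρ hz h3 h4) hord
    _ ≤ ∑ z ∈ (weilZeroIndex_finite T₂).toFinset,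
          (riemannZetaZeroOrder z : ℝ) * ‖weilMellin g z‖ ^ 2 :=
        Finset.sum_le_sum_of_subset_of_nonneg hsub fun z hz _ ↦
          mul_nonneg (re_term_weilZeroIndex hRH hg ((Set.Finite.mem_toFinset _).1 hz)).2
            (sq_nonneg _)
    _ ≤ (weilQuadratic g).re := sum_weilZeroIndex_le_re_weilQuadratic hRH hg T₂

/-- **Window mass bound on the critical line (RH), ordinate form.** Under RH, if `0 ≤ T₁ ≤ T₂`
and `|ĝ(½ + iγ)|² ≥ m` for all real `γ ∈ (T₁, T₂]`, then `m · (N(T₂) − N(T₁)) ≤ Re Q(g)`.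
(The hypothesis is on the transform along the critical line only; RH places the zeros there.)
[cite: Bombieri2000Weil, Thm 2] -/
theorem mul_zetaZeroCount_sub_le_re_weilQuadratic_of_line (hRH : _root_.RiemannHypothesis)
    {g : ℝ → ℂ} (hg : IsWeilTest g) {T₁ T₂ m : ℝ} (h0 : 0 ≤ T₁) (h12 : T₁ ≤ T₂)
    (hlow : ∀ γ : ℝ, T₁ < γ → γ ≤ T₂ → m ≤ ‖weilMellin g (1 / 2 + γ * I)‖ ^ 2) :
    m * ((zetaZeroCount T₂ : ℝ) - zetaZeroCount T₁) ≤ (weilQuadratic g).re := by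
  refine mul_zetaZeroCount_sub_le_re_weilQuadratic hRH hg h0 h12 fun ρ hz h3 h4 ↦ ?_
  have hne : ρ ≠ 1 := by
    rintro rfl
    simp at h3; linarith
  have hre : ρ.re = 1 / 2 := by
    refine hRH ρ hz ?_ hne
    rintro ⟨n, rfl⟩
    simp at h3; linarith
  have hρ : ρ = 1 / 2 + (ρ.im : ℝ) * I := by
    apply Complex.ext
    · simp [hre]
    · simp
  rw [hρ]
  exact hlow ρ.im h3 h4

end Summit.RiemannHypothesis.RiemannHypothesis.Theorems
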